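import Mathlib.Analysis.Real.Pi.Bounds
import Literature.MathematicalPhysics.QuantumLattice.PlanarBandSommerfeldMass
import HarnessLib

/-!
# The Planckian ledger's exact dictionaries — `h/2e²`, `k_B/ħ`, the `α = 1` slope constant
# `K₁ = 2πk_Bmₑ/(e²h)` — and the certified arithmetic behind REFVALS-2 §131 (cell hubbard-downfold):
# Legros et al. 2019 and Grissonnanche et al. 2021

[LegrosEtAl2019PlanckianOverdoped, Eq. (1)] writes the slope of the `T`-linear resistivity per CuO₂ plane as
`A₁□ = α (h/2e²)/T_F` with `T_F = (πħ²/k_B)(n d/m*)` and `n d = (1 − p)/a²`, the Planckian coefficient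
`α` being defined by `ħ/τ = α k_B T`; [GrissonnancheEtAl2021PlanckianADMR] fits `1/τ_iso = A + α k_B T/ħ`
to angle-dependent magnetoresistance.  Every constant is exact in the 2019 SI, and the tree already
holds them: `planckSI`, `elementaryChargeSI`, `hbarSI` (`OnsagerLuttingerCount.lean`), `Sommerfeld.kB`
(`SommerfeldCoefficient.lean`), `PlanarSommerfeld.electronMassSI` and the certified planar specific-heat
coefficient `planarCoeff ∈ (0.098465, 0.098466)` (`PlanarBandSommerfeldMass.lean`).  Nothing is
re-declared; this file only combines them:

* §1 `kleinHalf = h/(2e²) ∈ (12906.403, 12906.404)` Ω; `planckRatePs = 10⁻¹²·k_B/ħ = 2π·10⁻¹² k_B/h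
  ∈ (0.130920, 0.130921)` ps⁻¹ K⁻¹ (Mathlib's `3.141592 < π < 3.141593`); `alphaOfSlope s = s/planckRatePs`
  for a measured `d(1/τ)/dT` in ps⁻¹ K⁻¹;
* §2 Eq. (1) ∘ `T_F` as one constant: `A₁□(α = 1) = K₁ a² (m*/mₑ)/(1 − p)` with
  `K₁ = 2π k_B mₑ/(e² h) × 10⁻²⁰ ∈ (0.046459, 0.046461)` Ω K⁻¹ Å⁻² (`slopeConst`, `planckSlope`,
  `planckSlope_eq`); the sheet distance `d = A₁/A₁□` (`sheetDistance`);
* §3 [LegrosEtAl2019PlanckianOverdoped, pp. 3–5 and Methods]: Bi2212 `d = 0.62 μΩ cm K⁻¹ / 8.0 Ω K⁻¹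
  = 7.75 Å`, Nd-LSCO `0.49/7.4 ∈ (6.62, 6.63)` Å (16 T) and `0.47/7.4 ∈ (6.35, 6.36)` (33 T) against the
  printed `c/2 = 6.6` Å; `α` as measured/predicted `8.0/7.4 ∈ (1.081, 1.082)` (printed `1.1 ± 0.3`) and
  `8.2/8.9 ∈ (0.921, 0.922)` (`0.9 ± 0.3`); the printed `α = 1` predictions `7.4` (Bi2212: `m* = 8.4`,
  `1 − p = 0.77`) and `8.9` Ω/K (LSCO: `9.8`, `0.74`) are `planckSlope` at `a ∈ (3.820, 3.822)` resp.
  `(3.802, 3.804)` Å — i.e. at the two materials' in-plane constants (`legros_rows`, `legros_implied_cells`);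
  the PCCO mass `γ = 5.5 ⇒ m* ∈ (3.579, 3.581)` at `a = 3.95` Å (printed `3.6 ± 0.3`) and the Nd-LSCO
  «mean of 12 and 22» mass `17/c(3.78²) ∈ (12.08, 12.09)` (printed `12 ± 4`; end members `(8.52, 8.54)`
  and `(15.63, 15.64)`) through the tree's `massOfGamma` (`legros_masses`);
* §4 [GrissonnancheEtAl2021PlanckianADMR, Extended Data Table 2]: the isotropic rates `12.595, 11.937,
  10.663, 9.628` ps⁻¹ at `25, 20, 12, 6` K have least-squares slope `33.37675/212.75 ∈ (0.15688, 0.15689)`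
  ps⁻¹ K⁻¹, whence `α ∈ (1.1982, 1.1984)` — the printed «α = 1.2 ± 0.4» reproduced from the table; the
  two-point (25 K, 6 K) value `∈ (1.1927, 1.1929)`; the anisotropic rates `63.823, 63.565, 63.599, 63.929`
  spread by `< 0.4` ps⁻¹ («temperature independent») (`grissonnanche_rows`).

No named fact is introduced; `α` is a defined ratio, not a law.
-/

noncomputable section

namespace Literature.MathematicalPhysics.QuantumLattice.PlanckianSlope

open Real
open Literature.MathematicalPhysics.QuantumLattice
open Literature.MathematicalPhysics.QuantumLattice.PlanarSommerfeld
open Literature.MathematicalPhysics.QuantumManyBody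

/-! ## §1 `h/2e²` and `k_B/ħ` -/

/-- `h/(2e²)` (half the von Klitzing constant), the resistance quantum of
[cite: LegrosEtAl2019PlanckianOverdoped, Eq. (1)]. -/
def kleinHalf : ℝ := planckSI / (2 * elementaryChargeSI ^ 2)

/-- Unfolding lemma for `kleinHalf` [cite: LegrosEtAl2019PlanckianOverdoped, Eq. (1)]. -/
theorem kleinHalf_def : kleinHalf = planckSI / (2 * elementaryChargeSI ^ 2) := rfl

/-- `h/2e² ∈ (12906.403, 12906.404)` Ω (exact SI constants) [cite: LegrosEtAl2019PlanckianOverdoped, Eq. (1)]. -/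
theorem kleinHalf_bounds : 12906.403 < kleinHalf ∧ kleinHalf < 12906.404 := by
  unfold kleinHalf; rw [planckSI_def, elementaryChargeSI_def]; constructor <;> norm_num

/-- The Planckian rate per kelvin in ps⁻¹: `10⁻¹² k_B/ħ` [cite: GrissonnancheEtAl2021PlanckianADMR, Fig. 2c
(«1/τ = A + αk_BT/ħ»)]. -/
def planckRatePs : ℝ := Sommerfeld.kB / hbarSI / 10 ^ 12

/-- Unfolding lemma for `planckRatePs` [cite: GrissonnancheEtAl2021PlanckianADMR, Fig. 2c]. -/
theorem planckRatePs_def : planckRatePs = Sommerfeld.kB / hbarSI / 10 ^ 12 := rfl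

/-- `10⁻¹² k_B/ħ = 2π · 10⁻¹² k_B/h` [cite: GrissonnancheEtAl2021PlanckianADMR, Fig. 2c]. -/
theorem planckRatePs_eq : planckRatePs = π * (2 * Sommerfeld.kB / planckSI / 10 ^ 12) := by
  unfold planckRatePs hbarSI
  have hp : planckSI ≠ 0 := planckSI_pos.ne'
  have hpi : π ≠ 0 := Real.pi_pos.ne'
  field_simp

/-- `k_B/ħ ∈ (0.130920, 0.130921)` ps⁻¹ K⁻¹ [cite: GrissonnancheEtAl2021PlanckianADMR, Fig. 2c]. -/
theorem planckRatePs_bounds : 0.130920 < planckRatePs ∧ planckRatePs < 0.130921 := by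
  rw [planckRatePs_eq]
  have h1 : (3.141592 : ℝ) < π := Real.pi_gt_d6
  have h2 : π < (3.141593 : ℝ) := Real.pi_lt_d6
  have hq : (0.04167323 : ℝ) < 2 * Sommerfeld.kB / planckSI / 10 ^ 12 ∧
      2 * Sommerfeld.kB / planckSI / 10 ^ 12 < 0.04167324 := by
    rw [planckSI_def]; norm_num [Sommerfeld.kB]
  constructor <;> nlinarith [hq.1, hq.2]

/-- `planckRatePs > 0` [cite: GrissonnancheEtAl2021PlanckianADMR, Fig. 2c]. -/
theorem planckRatePs_pos : 0 < planckRatePs := lt_trans (by norm_num) planckRatePs_bounds.1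

/-- The Planckian coefficient of a measured slope `s = d(1/τ)/dT` (ps⁻¹ K⁻¹): `α = s ħ/k_B`
[cite: GrissonnancheEtAl2021PlanckianADMR, Fig. 2c]. -/
def alphaOfSlope (s : ℝ) : ℝ := s / planckRatePs

/-- Unfolding lemma for `alphaOfSlope` [cite: GrissonnancheEtAl2021PlanckianADMR, Fig. 2c]. -/
theorem alphaOfSlope_def (s : ℝ) : alphaOfSlope s = s / planckRatePs := rfl

/-- Bracketing `α` from a bracketed positive slope [cite: GrissonnancheEtAl2021PlanckianADMR, Fig. 2c]. -/
theorem alphaOfSlope_mem {s lo hi : ℝ} (hlo : 0 < lo) (h1 : lo ≤ s) (h2 : s ≤ hi) :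
    lo / 0.130921 < alphaOfSlope s ∧ alphaOfSlope s < hi / 0.130920 := by
  have hb := planckRatePs_bounds
  have hp := planckRatePs_pos
  unfold alphaOfSlope
  constructor
  · calc lo / 0.130921 < lo / planckRatePs := div_lt_div_of_pos_left hlo hp hb.2
      _ ≤ s / planckRatePs := div_le_div_of_nonneg_right h1 hp.le
  · calc s / planckRatePs ≤ hi / planckRatePs := div_le_div_of_nonneg_right h2 hp.le
      _ < hi / 0.130920 := div_lt_div_of_pos_left (by linarith) (by norm_num) hb.1

/-! ## §2 Eq. (1) of Legros et al. composed with `T_F` -/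

/-- `K₁ = 2π k_B mₑ/(e² h) × 10⁻²⁰` (Ω K⁻¹ Å⁻²): the `α = 1` slope per `(m*/mₑ) a²[Å²]/(1 − p)`, from
`A₁□ = (h/2e²)/T_F`, `T_F = πħ² n₂D/(k_B m*)`, `n₂D = (1 − p)/a²` [cite: LegrosEtAl2019PlanckianOverdoped,
Eq. (1) and Methods]. -/
def slopeConst : ℝ := 2 * π * Sommerfeld.kB * electronMassSI / (elementaryChargeSI ^ 2 * planckSI) / 10 ^ 20

/-- Unfolding lemma for `slopeConst` [cite: LegrosEtAl2019PlanckianOverdoped, Eq. (1)]. -/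
theorem slopeConst_def :
    slopeConst = 2 * π * Sommerfeld.kB * electronMassSI / (elementaryChargeSI ^ 2 * planckSI) / 10 ^ 20 := rfl

/-- `K₁` IS `(h/2e²)·k_B mₑ/(πħ²)·10⁻²⁰` — the composition of Eq. (1) with `T_F`
[cite: LegrosEtAl2019PlanckianOverdoped, Eq. (1)]. -/
theorem slopeConst_eq_klein :
    slopeConst = kleinHalf * (Sommerfeld.kB * electronMassSI / (π * hbarSI ^ 2)) / 10 ^ 20 := by
  unfold slopeConst kleinHalf hbarSI
  have hp : planckSI ≠ 0 := planckSI_pos.ne'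
  have he : elementaryChargeSI ≠ 0 := elementaryChargeSI_pos.ne'
  have hpi : π ≠ 0 := Real.pi_pos.ne'
  field_simp

/-- `K₁ ∈ (0.046459, 0.046461)` Ω K⁻¹ Å⁻² [cite: LegrosEtAl2019PlanckianOverdoped, Eq. (1)]. -/
theorem slopeConst_bounds : 0.046459 < slopeConst ∧ slopeConst < 0.046461 := by
  have e : slopeConst = π * (2 * Sommerfeld.kB * electronMassSI / (elementaryChargeSI ^ 2 * planckSI) / 10 ^ 20) := by
    unfold slopeConst; ring
  rw [e]
  have hq : (0.0147885 : ℝ) < 2 * Sommerfeld.kB * electronMassSI / (elementaryChargeSI ^ 2 * planckSI) / 10 ^ 20 ∧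
      2 * Sommerfeld.kB * electronMassSI / (elementaryChargeSI ^ 2 * planckSI) / 10 ^ 20 < 0.0147886 := by
    rw [planckSI_def, elementaryChargeSI_def, electronMassSI_def]; norm_num [Sommerfeld.kB]
  have h1 : (3.141592 : ℝ) < π := Real.pi_gt_d6
  have h2 : π < (3.141593 : ℝ) := Real.pi_lt_d6
  constructor <;> nlinarith [hq.1, hq.2]

/-- The `α = 1` Planckian slope per plane (Ω/K) for in-plane constant `a` (Å), doping `p` (electron-like
count `1 − p`) and mass `m` (units of mₑ) [cite: LegrosEtAl2019PlanckianOverdoped, Eq. (1), Methods and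
Fig. 3b caption («A₁□ = (m*/n)(k_B/e²d) (= h/2e²T_F)»)]. -/
def planckSlope (a p m : ℝ) : ℝ := slopeConst * a ^ 2 * m / (1 - p)

/-- Unfolding lemma for `planckSlope` [cite: LegrosEtAl2019PlanckianOverdoped, Eq. (1)]. -/
theorem planckSlope_def (a p m : ℝ) : planckSlope a p m = slopeConst * a ^ 2 * m / (1 - p) := rfl

/-- The predicted slope is monotone in `a²`: bracketing lemma used for the implied-cell rows
[cite: LegrosEtAl2019PlanckianOverdoped, Methods]. -/
theorem planckSlope_lt_of_lt {a b p m : ℝ} (ha : 0 ≤ a) (hab : a < b) (hp : p < 1) (hm : 0 < m) :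
    planckSlope a p m < planckSlope b p m := by
  unfold planckSlope
  have hK := slopeConst_bounds
  have hK0 : 0 < slopeConst := by linarith [hK.1]
  have h1p : 0 < 1 - p := by linarith
  apply div_lt_div_of_pos_right _ h1p
  have : a ^ 2 < b ^ 2 := by nlinarith
  nlinarith [mul_pos hK0 hm]

/-- The (average) CuO₂-sheet distance a pair `(A₁ [μΩ cm K⁻¹], A₁□ [Ω K⁻¹])` encodes, in Å:
`d = A₁/A₁□` with `1 μΩ cm = 10⁻⁸ Ω m = 100 Ω Å` [cite: LegrosEtAl2019PlanckianOverdoped, p. 3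
(«A₁□ ≡ A₁/d»)]. -/
def sheetDistance (A1 A1sq : ℝ) : ℝ := 100 * A1 / A1sq

/-- Unfolding lemma for `sheetDistance` [cite: LegrosEtAl2019PlanckianOverdoped, p. 3]. -/
theorem sheetDistance_def (A1 A1sq : ℝ) : sheetDistance A1 A1sq = 100 * A1 / A1sq := rfl

/-! ## §3 Legros et al. 2019 rows -/

/-- [cite: LegrosEtAl2019PlanckianOverdoped, pp. 3–5 and Methods]: Bi2212 `(0.62, 8.0) ⇒ d = 7.75` Å;
Nd-LSCO `(0.49, 7.4) ⇒ (6.62, 6.63)`, `(0.47, 7.4) ⇒ (6.35, 6.36)` Å (printed `c/2 = 6.6`); `α` ratios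
`8.0/7.4 ∈ (1.081, 1.082)` and `8.2/8.9 ∈ (0.921, 0.922)`; the hole/electron slope contrast `8.0/1.5
∈ (5.33, 5.34)` («factor ~5»); LSCO `15/8 = 1.875` from `p = 0.26` to `0.21`. -/
theorem legros_rows :
    sheetDistance 0.62 8.0 = 7.75 ∧
    ((6.62 : ℝ) < sheetDistance 0.49 7.4 ∧ sheetDistance 0.49 7.4 < 6.63) ∧
    ((6.35 : ℝ) < sheetDistance 0.47 7.4 ∧ sheetDistance 0.47 7.4 < 6.36) ∧
    ((1.081 : ℝ) < 8.0 / 7.4 ∧ (8.0 : ℝ) / 7.4 < 1.082) ∧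
    ((0.921 : ℝ) < 8.2 / 8.9 ∧ (8.2 : ℝ) / 8.9 < 0.922) ∧
    ((5.33 : ℝ) < 8.0 / 1.5 ∧ (8.0 : ℝ) / 1.5 < 5.34) ∧ (15 : ℝ) / 8 = 1.875 := by
  refine ⟨by norm_num [sheetDistance], ⟨by norm_num [sheetDistance], by norm_num [sheetDistance]⟩,
    ⟨by norm_num [sheetDistance], by norm_num [sheetDistance]⟩, ⟨by norm_num, by norm_num⟩,
    ⟨by norm_num, by norm_num⟩, ⟨by norm_num, by norm_num⟩, by norm_num⟩

/-- The printed `α = 1` predictions are `planckSlope` at the materials' in-plane constants: Bi2212 `7.4` Ω/K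
(`m* = 8.4`, `1 − p = 0.77`) lies between the values at `a = 3.820` and `a = 3.822` Å; LSCO `8.9` Ω/K
(`9.8`, `0.74`) between `a = 3.802` and `3.804` Å [cite: LegrosEtAl2019PlanckianOverdoped, p. 5 and
Methods («A₁□ = h/(2e²T_F)»)]. -/
theorem legros_implied_cells :
    (planckSlope 3.820 0.23 8.4 < 7.4 ∧ 7.4 < planckSlope 3.822 0.23 8.4) ∧
    (planckSlope 3.802 0.26 9.8 < 8.9 ∧ 8.9 < planckSlope 3.804 0.26 9.8) := by
  have hK := slopeConst_bounds
  unfold planckSlope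
  refine ⟨⟨?_, ?_⟩, ⟨?_, ?_⟩⟩
  · rw [div_lt_iff₀ (by norm_num)]; nlinarith [hK.2]
  · rw [lt_div_iff₀ (by norm_num)]; nlinarith [hK.1]
  · rw [div_lt_iff₀ (by norm_num)]; nlinarith [hK.2]
  · rw [lt_div_iff₀ (by norm_num)]; nlinarith [hK.1]

/-- The masses behind the printed `α`'s, through the tree's `massOfGamma` (one sheet per cell, `n = 1`):
PCCO `γ = 5.5` at `a = 3.95` Å ⇒ `m* ∈ (3.579, 3.581)` (printed `3.6 ± 0.3`); Nd-LSCO `p = 0.24`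
«mean of 12 and 22» `= 17` mJ K⁻² mol⁻¹ at `a = 3.78` Å ⇒ `(12.08, 12.09)` (printed `12 ± 4`), end members
`12 ⇒ (8.52, 8.54)` and `22 ⇒ (15.63, 15.64)` [cite: LegrosEtAl2019PlanckianOverdoped, p. 4–5 and Methods
(Eq. 2)]. -/
theorem legros_masses :
    ((3.579 : ℝ) < massOfGamma (3.95 ^ 2) 5.5 1 ∧ massOfGamma (3.95 ^ 2) 5.5 1 < 3.581) ∧
    ((12 : ℝ) + 22) / 2 = 17 ∧
    ((12.08 : ℝ) < massOfGamma (3.78 ^ 2) 17 1 ∧ massOfGamma (3.78 ^ 2) 17 1 < 12.09) ∧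
    ((8.52 : ℝ) < massOfGamma (3.78 ^ 2) 12 1 ∧ massOfGamma (3.78 ^ 2) 12 1 < 8.54) ∧
    ((15.63 : ℝ) < massOfGamma (3.78 ^ 2) 22 1 ∧ massOfGamma (3.78 ^ 2) 22 1 < 15.64) := by
  have hl := cellCoeff_lsco
  have hp := cellCoeff_bracket (a2 := (3.95 : ℝ) ^ 2) (lo := 15.6025) (hi := 15.6025)
    (by norm_num) (by norm_num) (by norm_num)
  have hcpos : 0 < cellCoeff ((3.95 : ℝ) ^ 2) := by linarith [hp.1]
  have hlpos : 0 < cellCoeff ((3.78 : ℝ) ^ 2) := by linarith [hl.1]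
  simp only [massOfGamma_def, mul_one]
  refine ⟨⟨?_, ?_⟩, by norm_num, ⟨?_, ?_⟩, ⟨?_, ?_⟩, ⟨?_, ?_⟩⟩
  · rw [lt_div_iff₀ hcpos]; nlinarith [hp.2]
  · rw [div_lt_iff₀ hcpos]; nlinarith [hp.1]
  · rw [lt_div_iff₀ hlpos]; nlinarith [hl.2]
  · rw [div_lt_iff₀ hlpos]; nlinarith [hl.1]
  · rw [lt_div_iff₀ hlpos]; nlinarith [hl.2]
  · rw [div_lt_iff₀ hlpos]; nlinarith [hl.1]
  · rw [lt_div_iff₀ hlpos]; nlinarith [hl.2]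
  · rw [div_lt_iff₀ hlpos]; nlinarith [hl.1]

/-! ## §4 Grissonnanche et al. 2021: the isotropic rate table -/

/-- Least-squares slope of four points [cite: GrissonnancheEtAl2021PlanckianADMR, Fig. 2c («A linear fit to
1/τ_iso»)]. -/
def lsSlope4 (x1 x2 x3 x4 y1 y2 y3 y4 : ℝ) : ℝ :=
  let xb := (x1 + x2 + x3 + x4) / 4
  let yb := (y1 + y2 + y3 + y4) / 4
  ((x1 - xb) * (y1 - yb) + (x2 - xb) * (y2 - yb) + (x3 - xb) * (y3 - yb) + (x4 - xb) * (y4 - yb)) /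
    ((x1 - xb) ^ 2 + (x2 - xb) ^ 2 + (x3 - xb) ^ 2 + (x4 - xb) ^ 2)

/-- Unfolding lemma for `lsSlope4` [cite: GrissonnancheEtAl2021PlanckianADMR, Fig. 2c]. -/
theorem lsSlope4_def (x1 x2 x3 x4 y1 y2 y3 y4 : ℝ) :
    lsSlope4 x1 x2 x3 x4 y1 y2 y3 y4 =
      ((x1 - (x1 + x2 + x3 + x4) / 4) * (y1 - (y1 + y2 + y3 + y4) / 4) +
        (x2 - (x1 + x2 + x3 + x4) / 4) * (y2 - (y1 + y2 + y3 + y4) / 4) +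
        (x3 - (x1 + x2 + x3 + x4) / 4) * (y3 - (y1 + y2 + y3 + y4) / 4) +
        (x4 - (x1 + x2 + x3 + x4) / 4) * (y4 - (y1 + y2 + y3 + y4) / 4)) /
      ((x1 - (x1 + x2 + x3 + x4) / 4) ^ 2 + (x2 - (x1 + x2 + x3 + x4) / 4) ^ 2 +
        (x3 - (x1 + x2 + x3 + x4) / 4) ^ 2 + (x4 - (x1 + x2 + x3 + x4) / 4) ^ 2) := rfl

/-- [cite: GrissonnancheEtAl2021PlanckianADMR, Extended Data Table 2]: `1/τ_iso = 12.595, 11.937, 10.663,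
9.628` ps⁻¹ at `T = 25, 20, 12, 6` K.  Least-squares slope `= 33.37675/212.75 ∈ (0.15688, 0.15689)` ps⁻¹ K⁻¹
⇒ `α ∈ (1.1982, 1.1984)`; two-point `(12.595 − 9.628)/19 ∈ (0.15615, 0.15616)` ⇒ `α ∈ (1.1927, 1.1929)`
(printed «α = 1.2 ± 0.4»); the anisotropic rates `63.823, 63.565, 63.599, 63.929` ps⁻¹ all lie within
`0.4` ps⁻¹ of each other («temperature independent»). -/
theorem grissonnanche_rows :
    lsSlope4 25 20 12 6 12.595 11.937 10.663 9.628 = 33.37675 / 212.75 ∧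
    ((0.15688 : ℝ) < 33.37675 / 212.75 ∧ (33.37675 : ℝ) / 212.75 < 0.15689) ∧
    ((1.1982 : ℝ) < alphaOfSlope (33.37675 / 212.75) ∧ alphaOfSlope (33.37675 / 212.75) < 1.1984) ∧
    ((0.15615 : ℝ) < (12.595 - 9.628) / (25 - 6) ∧ ((12.595 : ℝ) - 9.628) / (25 - 6) < 0.15616) ∧
    ((1.1927 : ℝ) < alphaOfSlope ((12.595 - 9.628) / (25 - 6)) ∧
      alphaOfSlope ((12.595 - 9.628) / (25 - 6)) < 1.1929) ∧
    ((63.929 : ℝ) - 63.565 < 0.4 ∧ (63.565 : ℝ) ≤ 63.599 ∧ (63.599 : ℝ) ≤ 63.823 ∧ (63.823 : ℝ) ≤ 63.929) := by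
  have hb := planckRatePs_bounds
  have hp := planckRatePs_pos
  refine ⟨by norm_num [lsSlope4], ⟨by norm_num, by norm_num⟩, ⟨?_, ?_⟩, ⟨by norm_num, by norm_num⟩,
    ⟨?_, ?_⟩, by norm_num⟩
  · unfold alphaOfSlope; rw [lt_div_iff₀ hp]; nlinarith [hb.2]
  · unfold alphaOfSlope; rw [div_lt_iff₀ hp]; nlinarith [hb.1]
  · unfold alphaOfSlope; rw [lt_div_iff₀ hp]; nlinarith [hb.2]
  · unfold alphaOfSlope; rw [div_lt_iff₀ hp]; nlinarith [hb.1]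

end Literature.MathematicalPhysics.QuantumLattice.PlanckianSlope

end
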